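import Summits.Parity.BatemanHorn.Theorems.SoloInformedTrapezoidCancellation

/-!
# Calibration of the local `ℓ¹`-mean hypothesis

Ledger: this work (soloist programme `solo-Parity-informed`, the `d ≥ 3` rung below the parity wall).

The hypothesis `HooleyMeanLocal g θ η` of `erdosDivisorSumAsymptotic_of_hooleyMeanLocal` interpolates between a
theorem and the open problem:
* `hooleyMeanLocal_zero`: `HooleyMeanLocal g θ 0` holds unconditionally for every `θ` (the trivial bound
  `|S_g(h; e)| ≤ ρ_g(e)` and root Mertens `∑_{E<e≤2E} ρ_g(e) ≪ E`);
* `HooleyUnshiftedUniform g η` (a uniform-in-`h` power saving for the unshifted sums, no average) implies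
  `HooleyMeanLocal g θ η` for every `θ ≤ 1` (`hooleyMeanLocal_of_unshiftedUniform`), and is implied by the shifted
  hypothesis `HooleyShiftUniform g η` of `SoloInformedHooleyShiftHypothesis` (`hooleyUnshiftedUniform_of_hooleyShiftUniform`);
* hence `erdosDivisorSumAsymptotic_cubic_of_unshiftedUniform`: for an irreducible cubic, a uniform power saving
  `∑_{E<e≤E'} S_g(h; e) ≪ E^{1−η}` (`|h| ≤ E`) with any `η > 1/3` gives Erdős's asymptotic.
So the cubic divisor problem is reduced to improving the exponent in `∑_{e≤x} S_g(h;e) ≪_h x^{1−η}` from the known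
`η = 0` (Hooley 1964: a saving of `(log x)^{−δ}` only) to any `η > 1/3`, on average over `|h| ≤ x^θ`, `θ > 2/3`.
-/

namespace Summit.Parity.BatemanHorn.Theorems

open Finset Polynomial
open Literature.NumberTheory.Sieve (polyRootCountMod)

/-! ### The trivial bound: `η = 0` -/

/-- Root Mertens on dyadic blocks: `∑_{E<e≤E'} ρ_g(e) ≤ R₁·E` for `E' ≤ 2E`. [folklore] -/
theorem exists_sum_Ioc_rootCount_le {g : ℤ[X]} (hirr : Irreducible g) (hdeg : 0 < g.natDegree) :
    ∃ R₁ : ℝ, 0 ≤ R₁ ∧ ∀ E E' : ℕ, 1 ≤ E → E ≤ E' → E' ≤ 2 * E →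
      ∑ e ∈ Ioc E E', (polyRootCountMod ![g] e : ℝ) ≤ R₁ * E := by
  obtain ⟨R₀, hR0, hR⟩ := exists_sum_Ioc_rootCount_div_le hirr hdeg
  refine ⟨2 * R₀, by positivity, fun E E' hE hEE' hE' => ?_⟩
  have key : ∀ e ∈ Ioc E E',
      (polyRootCountMod ![g] e : ℝ) ≤ (2 * E) * ((polyRootCountMod ![g] e : ℝ) / e) := by
    intro e he
    rw [mem_Ioc] at he
    have he0 : (0 : ℝ) < e := by exact_mod_cast (show 0 < e by omega)
    have he2 : (e : ℝ) ≤ 2 * E := by exact_mod_cast (show e ≤ 2 * E by omega)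
    have hρ : (0 : ℝ) ≤ polyRootCountMod ![g] e := Nat.cast_nonneg _
    rw [mul_div_assoc', le_div_iff₀ he0]
    nlinarith
  calc ∑ e ∈ Ioc E E', (polyRootCountMod ![g] e : ℝ)
      ≤ ∑ e ∈ Ioc E E', (2 * E) * ((polyRootCountMod ![g] e : ℝ) / e) := sum_le_sum key
    _ = (2 * E) * ∑ e ∈ Ioc E E', (polyRootCountMod ![g] e : ℝ) / e := by rw [mul_sum]
    _ ≤ (2 * E) * R₀ := mul_le_mul_of_nonneg_left (hR E E' hE hEE' hE') (by positivity)
    _ = 2 * R₀ * E := by ring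

/-- **The trivial bound:** `HooleyMeanLocal g θ 0` for every `θ`, unconditionally (`|S_g(h;e)| ≤ ρ_g(e)` and root
Mertens). [this work] -/
theorem hooleyMeanLocal_zero {g : ℤ[X]} (hirr : Irreducible g) (hdeg : 0 < g.natDegree) (θ : ℝ) :
    HooleyMeanLocal g θ 0 := by
  obtain ⟨R₁, hR0, hR⟩ := exists_sum_Ioc_rootCount_le hirr hdeg
  refine ⟨2 * R₁, fun E E' H hE hEE' hE' _ => ?_⟩
  have hblock : ∀ h : ℤ, ‖∑ e ∈ Ioc E E', hooleySum g e h‖ ≤ R₁ * E := fun h =>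
    (norm_sum_le _ _).trans ((sum_le_sum fun e _ => norm_hooleySum_le g e h).trans (hR E E' hE hEE' hE'))
  have key : ∀ h ∈ Icc 1 H,
      ‖∑ e ∈ Ioc E E', hooleySum g e h‖ + ‖∑ e ∈ Ioc E E', hooleySum g e (-(h : ℤ))‖ ≤ 2 * (R₁ * E) := by
    intro h _
    have h1 := hblock h
    have h2 := hblock (-(h : ℤ))
    linarith
  refine (sum_le_sum key).trans ?_
  rw [sum_const, Nat.card_Icc, Nat.add_sub_cancel, nsmul_eq_mul, sub_zero, Real.rpow_one]
  nlinarith [hR0, (Nat.cast_nonneg H : (0 : ℝ) ≤ H), (Nat.cast_nonneg E : (0 : ℝ) ≤ E)]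

/-! ### The uniform unshifted hypothesis -/

/-- **UNIFORM POWER SAVING IN UNSHIFTED HOOLEY SUMS** with exponent `η`: `‖∑_{E<e≤E'} S_g(h; e)‖ ≤ C·E^{1−η}` for
all `1 ≤ E ≤ E' ≤ 2E` and all `h ≠ 0` with `|h| ≤ E`.  A `Prop`; for `deg g ≥ 3` open for every `η > 0`.
[this work; after Hooley 1964] -/
def HooleyUnshiftedUniform (g : ℤ[X]) (η : ℝ) : Prop :=
  ∃ C : ℝ, ∀ (h : ℤ) (E E' : ℕ), h ≠ 0 → 1 ≤ E → E ≤ E' → E' ≤ 2 * E → |h| ≤ E →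
    ‖∑ e ∈ Ioc E E', hooleySum g e h‖ ≤ C * (E : ℝ) ^ (1 - η)

/-- The shifted hypothesis implies the unshifted one (shift `b = 0`). [this work] -/
theorem hooleyUnshiftedUniform_of_hooleyShiftUniform {g : ℤ[X]} {η : ℝ} (hyp : HooleyShiftUniform g η) :
    HooleyUnshiftedUniform g η := by
  obtain ⟨C, hC⟩ := hyp
  refine ⟨C, fun h E E' hh hE hEE' hE' hhE => ?_⟩
  have := hC h 0 E E' hh hE hEE' hE' hhE le_rfl (by positivity)
  simpa only [hooleySumShift_zero] using this

/-- **`HooleyUnshiftedUniform g η ⟹ HooleyMeanLocal g θ η`** for every `θ ≤ 1`. [this work] -/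
theorem hooleyMeanLocal_of_unshiftedUniform {g : ℤ[X]} {θ η : ℝ} (hθ : θ ≤ 1)
    (hyp : HooleyUnshiftedUniform g η) : HooleyMeanLocal g θ η := by
  obtain ⟨C, hC⟩ := hyp
  have hC0 : ∀ E : ℕ, 1 ≤ E → 0 ≤ C * (E : ℝ) ^ (1 - η) := fun E hE =>
    (norm_nonneg _).trans (hC 1 E E one_ne_zero hE le_rfl (by omega) (by simp; omega))
  refine ⟨2 * C, fun E E' H hE hEE' hE' hH => ?_⟩
  have hE1 : (1 : ℝ) ≤ E := by exact_mod_cast hE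
  have hHE : (H : ℝ) ≤ E := hH.trans (by simpa using Real.rpow_le_rpow_of_exponent_le hE1 hθ)
  have hHE' : H ≤ E := by exact_mod_cast hHE
  have key : ∀ h ∈ Icc 1 H,
      ‖∑ e ∈ Ioc E E', hooleySum g e h‖ + ‖∑ e ∈ Ioc E E', hooleySum g e (-(h : ℤ))‖
        ≤ 2 * (C * (E : ℝ) ^ (1 - η)) := by
    intro h hh
    rw [mem_Icc] at hh
    have hh0 : (h : ℤ) ≠ 0 := by exact_mod_cast (show h ≠ 0 by omega)
    have hhE : |(h : ℤ)| ≤ E := by rw [abs_of_nonneg (by positivity)]; exact_mod_cast hh.2.trans hHE'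
    have h1 := hC h E E' hh0 hE hEE' hE' hhE
    have h2 := hC (-(h : ℤ)) E E' (neg_ne_zero.mpr hh0) hE hEE' hE' (by rwa [abs_neg])
    linarith
  refine (sum_le_sum key).trans ?_
  rw [sum_const, Nat.card_Icc, nsmul_eq_mul]
  have := hC0 E hE
  push_cast
  nlinarith

/-- **Erdős's asymptotic for cubics from a uniform unshifted power saving `η > 1/3`:** for an irreducible cubic
`g`, `HooleyUnshiftedUniform g η` with `η > 1/3` gives `∑_{n≤x} τ(g(n)) ~ 3·A_g·x log x`. [this work] -/
theorem erdosDivisorSumAsymptotic_cubic_of_unshiftedUniform {g : ℤ[X]} (hirr : Irreducible g)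
    (hdeg : g.natDegree = 3) {η : ℝ} (hη : 1 / 3 < η) (hyp : HooleyUnshiftedUniform g η) :
    ErdosDivisorSumAsymptotic g :=
  erdosDivisorSumAsymptotic_cubic_of_hooleyMeanLocal hirr hdeg (by norm_num : (2 : ℝ) / 3 < 1) le_rfl hη
    (hooleyMeanLocal_of_unshiftedUniform le_rfl hyp)

/-- The general degree: for `g` irreducible of degree `d ≥ 3`, `HooleyUnshiftedUniform g η` with `η > 1 − 2/d`
gives Erdős's asymptotic, PROVIDED `2 − 4/d < 1`, i.e. `d = 3` (for `d ≥ 4` the frequency condition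
`θ > 2 − 4/d ≥ 1` is incompatible with `θ ≤ 1` and the theorem is vacuous — recorded here as the honest range).
[this work] -/
theorem erdosDivisorSumAsymptotic_of_unshiftedUniform {g : ℤ[X]} (hirr : Irreducible g)
    (hdeg : 3 ≤ g.natDegree) (hd : 2 - 4 / (g.natDegree : ℝ) < 1) {η : ℝ}
    (hη : 1 - 2 / (g.natDegree : ℝ) < η) (hyp : HooleyUnshiftedUniform g η) : ErdosDivisorSumAsymptotic g :=
  erdosDivisorSumAsymptotic_of_hooleyMeanLocal hirr hdeg hd le_rfl hη
    (hooleyMeanLocal_of_unshiftedUniform le_rfl hyp)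

end Summit.Parity.BatemanHorn.Theorems
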